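import Literature.Geometry.Riemannian.SurgicalSolutions
import Literature.Geometry.Riemannian.CanonicalNeighbourhoodScaling
import HarnessLib

/-!
# The base of Chen–Zhu's induction without the normalisation `T₀ > 1`
(topic `Geometry/Riemannian`)

`SurgicalSolutions.lean` proves the base of the inductive construction of §5 of Chen–Zhu 2006
(arXiv:math/0504478, p. 26: "It follows from Lemma 2.1 and Theorem 4.1 that the a priori
assumptions above hold for the smooth solution on `[0, T₀)`") as `chenZhuAPriori_smoothSolution`,
for maximal flows with `T > 1` — the normalisation "Without loss of generality, after a scaling on
the initial metric, we may assume `T₀ > 1`" being built into the named fact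
`chenZhu_aprioriAssumptions_smoothSolution` (Thm. 4.1 as used on p. 26). With the scale
covariance of the canonical neighbourhood assumption (`CanonicalNeighbourhoodScaling.lean`,
`canonicalNeighbourhoods_smoothSolution_of_normalised`) the normalisation is now DISCHARGED: the a
priori assumptions hold for the maximal Ricci flow from every metric of positive isotropic
curvature on a closed simply connected 4-manifold, whatever its maximal time
(`chenZhuAPriori_smoothSolution_unnormalised`). The pinching assumption needs no rescaling:
Lemma 2.1 (`hamilton_chenZhu_pinching`) is stated for every initial metric. This is the base
("admissible data at time `0`") required by `chenZhu_surgicalSolution_existence_of_step`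
(`SurgicalSolutionsCount.lean`) for the initial manifold of Thm. 5.6.

## References

* B.-L. Chen, X.-P. Zhu, *Ricci flow with surgery on four-manifolds with positive isotropic
  curvature*, J. Differential Geom. 74 (2006), arXiv:math/0504478, §5, p. 26. [ChenZhu2006]
-/

noncomputable section

open Bundle Set Function TopologicalSpace
open scoped Manifold ContDiff Topology

namespace Literature.Geometry.Riemannian

open Lorentzian

/-- **The smooth maximal solution satisfies the a priori assumptions, for every maximal time**
(Chen–Zhu 2006, §5, p. 26, with the normalisation "we may assume `T₀ > 1`" carried out by
parabolic rescaling): for all sufficiently small accuracies `0 < ε ≤ ε₀`, with `η` universal and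
`C₁, C₂` depending only on `ε`, every maximal Ricci flow `(g, cov)` on `[0, T)` from a metric of
positive isotropic curvature on a closed simply connected 4-manifold satisfies the a priori
assumptions `ChenZhuAPriori ⟨ε, C₁, C₂, η, ρ, Λ, P, r⟩ g cov T 0` for some positive `ρ, Λ, P`
(Lemma 2.1, `hamilton_chenZhu_pinching`) and some positive non-increasing `r`
(`canonicalNeighbourhoods_smoothSolution_of_normalised`), positive isotropic curvature being
preserved (`ricciFlow_preserves_positiveIsotropicCurvature`). Compared with
`chenZhuAPriori_smoothSolution` the hypothesis `1 < T` is gone. [cite: ChenZhu2006, §5, p. 26] -/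
theorem chenZhuAPriori_smoothSolution_unnormalised
    (h₁ : ricciFlow_preserves_positiveIsotropicCurvature.{0}) (h₂ : hamilton_chenZhu_pinching.{0})
    (h₃ : chenZhu_aprioriAssumptions_smoothSolution) :
    ∃ η : ℝ, 0 < η ∧ ∃ ε₀ : ℝ, 0 < ε₀ ∧ ∀ ε : ℝ, 0 < ε → ε ≤ ε₀ → ∃ C₁ C₂ : ℝ, 0 < C₁ ∧ 0 < C₂ ∧
      ∀ (M : Type) [TopologicalSpace M] [T2Space M] [SecondCountableTopology M] [CompactSpace M]
        [ChartedSpace (EuclideanSpace ℝ (Fin 4)) M] [IsManifold (𝓡 4) ∞ M] [SimplyConnectedSpace M]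
        [MeasurableSpace M] [BorelSpace M]
        (g : ℝ → PseudoRiemannianMetric (𝓡 4) ∞ (EuclideanSpace ℝ (Fin 4))
          (TangentSpace (𝓡 4) : M → Type _))
        (cov : ℝ → CovariantDerivative (𝓡 4) (EuclideanSpace ℝ (Fin 4))
          (TangentSpace (𝓡 4) : M → Type _)) (T : ℝ),
        IsMaximalRicciFlow g cov T → (g 0).HasPositiveIsotropicCurvature →
          ∃ ρ Λ P : ℝ, 0 < ρ ∧ 0 < Λ ∧ 0 < P ∧
            ∃ r : ℝ → ℝ, (∀ t ∈ Ici (0 : ℝ), 0 < r t) ∧ AntitoneOn r (Ici 0) ∧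
              ChenZhuAPriori ⟨ε, C₁, C₂, η, ρ, Λ, P, r⟩ g cov T 0 := by
  obtain ⟨η, hη, ε₀, hε₀, H⟩ := canonicalNeighbourhoods_smoothSolution_of_normalised h₃
  refine ⟨η, hη, ε₀, hε₀, fun ε hε hεε₀ ↦ ?_⟩
  obtain ⟨C₁, C₂, hC₁, hC₂, Hcan⟩ := H ε hε hεε₀
  refine ⟨C₁, C₂, hC₁, hC₂, fun M _ _ _ _ _ _ _ _ _ g cov T hmax hpic ↦ ?_⟩
  obtain ⟨ρ, Λ, P, hρ, hΛ, hP, hpinch⟩ := h₂ M (g 0) (hmax.isRiemannian 0 hmax.zero_mem) hpic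
  obtain ⟨r, hr, hanti, hcan⟩ := Hcan M g cov T hmax hpic
  refine ⟨ρ, Λ, P, hρ, hΛ, hP, r, hr, hanti, ?_, ?_, ?_⟩
  · exact h₁ M T g cov hmax.isRicciFlow hmax.isRiemannian hpic
  · intro t ht x e he
    simpa only [zero_add] using hpinch T g cov hmax.isRicciFlow hmax.isRiemannian rfl t ht x e he
  · intro t ht x hR _
    exact hcan t ht x (by simpa only [zero_add] using hR)

/-- **Admissible data at time `0`, for the count**: in the vocabulary of
`SurgicalSolutionsCount.lean`, the initial manifold of Thm. 5.6 carries a first stage — a maximal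
Ricci flow from `g₀` satisfying the a priori assumptions started at absolute time `0` — for every
PIC metric `g₀` on a closed simply connected 4-manifold (the maximal solution exists by
`ricciFlow_maximal_existence`, the all-time alternative being excluded by `ricciFlow_singularTime_le`
and the positive lower bound of the scalar curvature, as in
`exists_isMaximalRicciFlow_of_hasPositiveIsotropicCurvature`).
[cite: ChenZhu2006, §5, p. 26] -/
theorem exists_first_stage_chenZhuAPriori
    (h₀ : ricciFlow_maximal_existence.{0, 0, 0}) (h₀' : ricciFlow_singularTime_le.{0, 0, 0})
    (h₀'' : exists_pos_le_scalarCurvature_of_hasPositiveIsotropicCurvature.{0})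
    (h₁ : ricciFlow_preserves_positiveIsotropicCurvature.{0}) (h₂ : hamilton_chenZhu_pinching.{0})
    (h₃ : chenZhu_aprioriAssumptions_smoothSolution) :
    ∃ η : ℝ, 0 < η ∧ ∃ ε₀ : ℝ, 0 < ε₀ ∧ ∀ ε : ℝ, 0 < ε → ε ≤ ε₀ → ∃ C₁ C₂ : ℝ, 0 < C₁ ∧ 0 < C₂ ∧
      ∀ (M : Type) [TopologicalSpace M] [T2Space M] [SecondCountableTopology M] [CompactSpace M]
        [ChartedSpace (EuclideanSpace ℝ (Fin 4)) M] [IsManifold (𝓡 4) ∞ M] [SimplyConnectedSpace M]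
        [MeasurableSpace M] [BorelSpace M]
        (g₀ : PseudoRiemannianMetric (𝓡 4) ∞ (EuclideanSpace ℝ (Fin 4))
          (TangentSpace (𝓡 4) : M → Type _)),
        g₀.IsRiemannian → g₀.HasPositiveIsotropicCurvature →
          ∃ ρ Λ P : ℝ, 0 < ρ ∧ 0 < Λ ∧ 0 < P ∧
            ∃ r : ℝ → ℝ, (∀ t ∈ Ici (0 : ℝ), 0 < r t) ∧ AntitoneOn r (Ici 0) ∧
              ∃ (g : ℝ → PseudoRiemannianMetric (𝓡 4) ∞ (EuclideanSpace ℝ (Fin 4))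
                  (TangentSpace (𝓡 4) : M → Type _))
                (cov : ℝ → CovariantDerivative (𝓡 4) (EuclideanSpace ℝ (Fin 4))
                  (TangentSpace (𝓡 4) : M → Type _)) (T : ℝ),
                IsMaximalRicciFlow g cov T ∧ g 0 = g₀ ∧
                  ChenZhuAPriori ⟨ε, C₁, C₂, η, ρ, Λ, P, r⟩ g cov T 0 := by
  obtain ⟨η, hη, ε₀, hε₀, H⟩ := chenZhuAPriori_smoothSolution_unnormalised h₁ h₂ h₃
  refine ⟨η, hη, ε₀, hε₀, fun ε hε hεε₀ ↦ ?_⟩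
  obtain ⟨C₁, C₂, hC₁, hC₂, HM⟩ := H ε hε hεε₀
  refine ⟨C₁, C₂, hC₁, hC₂, fun M _ _ _ _ _ _ _ _ _ g₀ hg₀ hpic ↦ ?_⟩
  rcases h₀ (𝓡 4) M g₀ hg₀ with ⟨g, cov, hflow, hR, h0⟩ | ⟨T, hT, g, cov, hmax, h0⟩
  · -- an all-time flow from PIC data is impossible (`T ≤ 2/α` for every `T`)
    exfalso
    have h0' : (g 0).HasPositiveIsotropicCurvature := h0 ▸ hpic
    have hLC : (g 0).IsLeviCivita (cov 0) := hflow.isLeviCivita 0 (by simp)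
    obtain ⟨α₀, hα₀, hα₀R⟩ := h₀'' M (g 0) (cov 0) (hR 0 (by simp)) hLC (h0' (cov 0) hLC)
    have key : ∀ T' : ℝ, 0 < T' → T' ≤ 2 / α₀ := by
      intro T' hT'
      have := h₀' (𝓡 4) M T' hT' g cov (hflow.mono Ico_subset_Ici_self) (fun t ht ↦ hR t ht.1)
        α₀ hα₀ hα₀R
      have hrank : (Module.finrank ℝ (EuclideanSpace ℝ (Fin 4)) : ℝ) = 4 := by simp
      rw [hrank] at this
      calc T' ≤ 4 / (2 * α₀) := this
        _ = 2 / α₀ := by field_simp; norm_num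
    have := key (2 / α₀ + 1) (by positivity)
    linarith
  · obtain ⟨ρ, Λ, P, hρ, hΛ, hP, r, hr, hanti, hap⟩ := HM M g cov T hmax (h0 ▸ hpic)
    exact ⟨ρ, Λ, P, hρ, hΛ, hP, r, hr, hanti, g, cov, T, hmax, h0, hap⟩

end Literature.Geometry.Riemannian

end
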